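import Literature.MathematicalPhysics.QuantumFieldTheory.BalabanImbrieJaffe1984to88.BIJ88Sect5StatementsPart3
import Literature.MathematicalPhysics.QuantumFieldTheory.BalabanImbrieJaffe1984to88.BIJ88Eq215Proof

/-!
# `BalabanImbrieJaffe1984to88.BIJ88Eq551Proof` — T. Bałaban, J. Imbrie, A. Jaffe, *Effective action and cluster properties of the
abelian Higgs model*, Commun. Math. Phys. **114** (1988) 257–315 [BalabanImbrieJaffe1988]: (5.5.1) p. 283, `σ_k∂A′ = Q^e_k∂H_kA′`
*"by (I.6.1.5), (2.15)"* — PROVED as operator algebra from (2.15) and the [I] inputs (I.5.3.1), (I.6.1.4) (⇐ (2.21) + ∂∂ = 0),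
`∂Q^{s*}_k = Q^{e*}_k∂`, in a ring and for linear maps between the four field spaces

statement-level skeleton of published theorems with citation tags; proofs where landed; nothing here is a claim about the Yang–Mills mass gap

PDF held: `paper:balaban1988-cmp114-bij-abelian-higgs-effective-action` (journal page = PDF page + 256), p. 283 [PDF 27] (r16's render
transcription in `BIJ88Sect5StatementsPart3`); [I] = [BalabanImbrieJaffe1985] p. 319 [PDF 21] read this session from the text layer of
`paper:balaban1985-cmp97-bij-higgs-minimizers`.

WHAT IS REPRODUCED.  The **(5.5.1) member of SKELETON row C2.Eq5.5.1-5.5.12** (cell `lit-balaban`, HOME `run/shared/lean/pub/lit-balaban/`;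
Phase-2 seat p02 gen 3 = unit `lit-balaban-p02`, G.2(b) knitting identity; C2 §5 fold owner r16, referee ref-5; TAKING line HOME/STATUS.md
2026-08-21T04:27:11Z).  Before this file (5.5.1) was the `def … : Prop` `BIJ88Sect5StatementsPart3.Eq551` (typed p243601), entering
r16's kernel `eq554` ((5.5.4)) as the HYPOTHESIS `h551`.
p. 283, verbatim: *"The linear term is almost equal to ⟨Λ₁^{(k)**}L^{−2}Q^{e*}f, Q^e_k∂H_kA′⟩, since by (I.6.1.5), (2.15) we have
σ_k∂A′ = Q^e_k∂H_kA′. (5.5.1)"*; (2.15) p. 261: *"σ_k = Q^e_k(I − ∂G_{k,Ax}∂*)Q^{e*}_k = Q^e_k(I − ∂𝒟_k∂*)Q^{e*}_k"*; [I] p. 319: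
*"By (5.3.1), H_{k,Ax} = Q^{s*}_k − G_{k,Ax}∂*Q^{e*}_k∂. Apply ∂ to this identity, and use the gauge invariance statement
∂H_{k,Ax} = ∂H_k (6.1.4) and the identity ∂Q^{s*}_k = Q^{e*}_k∂. It follows that ∂H_k = (I − ∂G_{k,Ax}∂*)Q^{e*}_k∂. (6.1.5)"*;
(2.21) p. 262 = [I] (5.1.1): *"H_{k,Ax}B = H_kB + ∂D_kB"*.

WHAT IS PROVED HERE (0 `sorry`, standard axioms; theorems only).
§1 IN A RING OF OPERATORS (r18's/r16's typing).  `eq614_ring`: (I.6.1.4) `∂H_{k,Ax} = ∂H_k` from (2.21) `Eq221` and `∂∂ = 0` (curl ∘ grad,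
hypothesis `hdd`); `eq615_ring`: (I.6.1.5) from (I.5.3.1), (I.6.1.4), `∂Q^{s*}_k = Q^{e*}_k∂` (the ring copy of p30's linear-map
`BIJ85Eq611Proof.eq615`); **`eq551_of_615`**: (I.6.1.5) ⟹ `Eq551 (sigmaOp Q^e_k Q^{e*}_k ∂ ∂* G_{k,Ax}) ∂₁ Q^e_k ∂ H_k` (r18's (2.15)
`sigmaOp`, `∂₁` the unit-lattice ∂ on the left, `∂` the η-lattice one); **`eq551_of_531`**: the whole chain from the printed inputs;
`eq551_curlyD`: the same for the `𝒟_k` form of σ_k, given (2.15) `Eq215`.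
§2 AS LINEAR MAPS between the four field spaces `B₁` (unit-lattice 1-forms A′), `A` (η-lattice 1-forms), `P₁`, `P_η` (2-forms): `eq615_lin`
(plain-module copy of `BIJ85Eq611Proof.eq615`, any commutative coefficient ring), **`eq551_lin`**:
`(Q^e_k ∘ (id − ∂∘G∘∂*) ∘ Q^{e*}_k) ∘ ∂₁ = Q^e_k ∘ ∂ ∘ H_k`, and **`eq551_emb`**: r16's ring-level `Eq551` composed with r18's ring-level
`sigmaOp` HOLDS in the one ring `Module.End 𝕜 V` for the operators embedded through the `Slot`/`emb` dictionary of `BIJ88Eq215Proof`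
(`sigmaOp_emb`, `emb_mul`).
HONEST SCOPE.  The inputs (I.5.3.1), (2.21), `∂∂ = 0`, `∂Q^{s*}_k = Q^{e*}_k∂` are displayed hypotheses here (on the series' tori they are
the accepted `BIJ85Eq531Proof.eq531_torus`, `BIJ85Prop521Proof`, `LatticeFieldCalculus`, `BIJ85CurlQsstar`); the "almost equal" sentence
and the bounds (5.5.5) are not touched (p36's `BIJ88Ineq555Proof`); nothing on d = 4 or the continuum; NOT summit progress.
-/

namespace Literature.MathematicalPhysics.QuantumFieldTheory.BalabanImbrieJaffe1984to88.BIJ88Eq551Proof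

open BIJ88Sect2Statements BIJ88Sect5StatementsPart3 BIJ88Eq215Proof

/-! ## §1  In a ring of operators -/

section Ring

variable {R : Type*} [Ring R]

/-- **[I] (6.1.4)** `∂H_{k,Ax} = ∂H_k` — *"the gauge invariance statement"* — from (2.21)/(I.5.1.1) `H_{k,Ax} = H_k + ∂_gD_k` and
`∂∂_g = 0` (curl of a gradient; `dg` = the gradient ∂ on scalars, `dη` = the curl ∂ on 1-forms). [cite: BalabanImbrieJaffe1985, (6.1.4) p.319] -/
theorem eq614_ring (HAx Hk dg Dk dη : R) (h221 : Eq221 HAx Hk dg Dk) (hdd : dη * dg = 0) : dη * HAx = dη * Hk := by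
  unfold Eq221 at h221
  rw [h221, mul_add, ← mul_assoc, hdd, zero_mul, add_zero]

/-- **[I] (6.1.5)** `∂H_k = (I − ∂G_{k,Ax}∂*)Q^{e*}_k∂₁` from (I.5.3.1) `H_{k,Ax} = Q^{s*}_k − G_{k,Ax}∂*Q^{e*}_k∂₁`, (6.1.4) and
`∂Q^{s*}_k = Q^{e*}_k∂₁` — the ring copy of p30's `BIJ85Eq611Proof.eq615`. [cite: BalabanImbrieJaffe1985, (6.1.5) p.319] -/
theorem eq615_ring (HAx Hk Qss GAx dη dηs Qes d₁ : R) (h531 : HAx = Qss - GAx * dηs * Qes * d₁)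
    (h614 : dη * HAx = dη * Hk) (hdQ : dη * Qss = Qes * d₁) :
    dη * Hk = (1 - dη * GAx * dηs) * Qes * d₁ := by
  rw [← h614, h531, mul_sub, hdQ]
  noncomm_ring

/-- **(5.5.1) from (I.6.1.5) and (2.15)**: with `σ_k = Q^e_k(I − ∂G_{k,Ax}∂*)Q^{e*}_k` (r18's `sigmaOp`), `σ_k∂₁ = Q^e_k∂H_k` — r16's
`Eq551`. [cite: BalabanImbrieJaffe1988, (5.5.1) p.283] -/
theorem eq551_of_615 (Qe Qes dη dηs GAx d₁ Hk : R) (h615 : dη * Hk = (1 - dη * GAx * dηs) * Qes * d₁) :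
    Eq551 (sigmaOp Qe Qes dη dηs GAx) d₁ Qe dη Hk := by
  unfold Eq551 sigmaOp
  rw [mul_assoc Qe dη Hk, h615]
  noncomm_ring

/-- **(5.5.1), the whole printed chain**: from (I.5.3.1), (2.21), `∂∂_g = 0` and `∂Q^{s*}_k = Q^{e*}_k∂₁`, `σ_k∂₁ = Q^e_k∂H_k`.
[cite: BalabanImbrieJaffe1988, (5.5.1) p.283] -/
theorem eq551_of_531 (Qe Qes dη dηs GAx d₁ Hk HAx Qss dg Dk : R) (h531 : HAx = Qss - GAx * dηs * Qes * d₁)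
    (h221 : Eq221 HAx Hk dg Dk) (hdd : dη * dg = 0) (hdQ : dη * Qss = Qes * d₁) :
    Eq551 (sigmaOp Qe Qes dη dηs GAx) d₁ Qe dη Hk :=
  eq551_of_615 Qe Qes dη dηs GAx d₁ Hk
    (eq615_ring HAx Hk Qss GAx dη dηs Qes d₁ h531 (eq614_ring HAx Hk dg Dk dη h221 hdd) hdQ)

/-- (5.5.1) for the second form of (2.15), `σ_k = Q^e_k(I − ∂𝒟_k∂*)Q^{e*}_k`, given the equality (2.15) `Eq215` of the two forms.
[cite: BalabanImbrieJaffe1988, (5.5.1) p.283] -/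
theorem eq551_curlyD (Qe Qes dη dηs GAx Dk d₁ Hk : R) (h215 : Eq215 Qe Qes dη dηs GAx Dk)
    (h551 : Eq551 (sigmaOp Qe Qes dη dηs GAx) d₁ Qe dη Hk) : Eq551 (sigmaOp Qe Qes dη dηs Dk) d₁ Qe dη Hk := by
  unfold Eq551 at h551 ⊢
  unfold Eq215 at h215
  rw [← h215]
  exact h551

end Ring

/-! ## §2  As linear maps between the four field spaces, and in the one ring `Module.End 𝕜 V` -/

section Lin

universe u v w

variable {𝕜 : Type u} [CommRing 𝕜]
variable {B₁ A P₁ Pη : Type v} [AddCommGroup B₁] [Module 𝕜 B₁] [AddCommGroup A] [Module 𝕜 A] [AddCommGroup P₁]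
  [Module 𝕜 P₁] [AddCommGroup Pη] [Module 𝕜 Pη]

/-- **[I] (6.1.5) for linear maps** (plain modules over any commutative coefficient ring; `BIJ85Eq611Proof.eq615` is the real
inner-product-space copy): `∂ ∘ H_k = (id − ∂∘G_{k,Ax}∘∂*) ∘ Q^{e*}_k ∘ ∂₁`. [cite: BalabanImbrieJaffe1985, (6.1.5) p.319] -/
theorem eq615_lin (d₁ : B₁ →ₗ[𝕜] P₁) (dη : A →ₗ[𝕜] Pη) (dηs : Pη →ₗ[𝕜] A) (G : A →ₗ[𝕜] A) (Qeks : P₁ →ₗ[𝕜] Pη)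
    (Qss Hax Hk : B₁ →ₗ[𝕜] A) (h531 : Hax = Qss - G ∘ₗ dηs ∘ₗ Qeks ∘ₗ d₁) (h614 : dη ∘ₗ Hax = dη ∘ₗ Hk)
    (hdQ : dη ∘ₗ Qss = Qeks ∘ₗ d₁) :
    dη ∘ₗ Hk = (LinearMap.id - dη ∘ₗ G ∘ₗ dηs) ∘ₗ Qeks ∘ₗ d₁ := by
  ext b
  have h1 : dη (Qss b) = Qeks (d₁ b) := by simpa using LinearMap.congr_fun hdQ b
  have h2 : dη (Hk b) = dη (Hax b) := by simpa using (LinearMap.congr_fun h614 b).symm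
  simp only [LinearMap.comp_apply, LinearMap.sub_apply, LinearMap.id_apply, h2, h531, map_sub, h1]

/-- **(5.5.1) for linear maps**: `(Q^e_k ∘ (id − ∂∘G_{k,Ax}∘∂*) ∘ Q^{e*}_k) ∘ ∂₁ = Q^e_k ∘ ∂ ∘ H_k : B₁ → P₁`, from (I.5.3.1), (I.6.1.4),
`∂Q^{s*}_k = Q^{e*}_k∂₁`. [cite: BalabanImbrieJaffe1988, (5.5.1) p.283] -/
theorem eq551_lin (d₁ : B₁ →ₗ[𝕜] P₁) (dη : A →ₗ[𝕜] Pη) (dηs : Pη →ₗ[𝕜] A) (G : A →ₗ[𝕜] A) (Qek : Pη →ₗ[𝕜] P₁)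
    (Qeks : P₁ →ₗ[𝕜] Pη) (Qss Hax Hk : B₁ →ₗ[𝕜] A) (h531 : Hax = Qss - G ∘ₗ dηs ∘ₗ Qeks ∘ₗ d₁)
    (h614 : dη ∘ₗ Hax = dη ∘ₗ Hk) (hdQ : dη ∘ₗ Qss = Qeks ∘ₗ d₁) :
    (Qek ∘ₗ (LinearMap.id - dη ∘ₗ G ∘ₗ dηs) ∘ₗ Qeks) ∘ₗ d₁ = Qek ∘ₗ dη ∘ₗ Hk := by
  have h615 := eq615_lin d₁ dη dηs G Qeks Qss Hax Hk h531 h614 hdQ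
  ext b
  have hb := LinearMap.congr_fun h615 b
  simp only [LinearMap.comp_apply, LinearMap.sub_apply, LinearMap.id_apply] at hb ⊢
  rw [hb]

variable {V : Type w} [AddCommGroup V] [Module 𝕜 V]

/-- **(5.5.1) in ONE ring**: with the four field spaces placed in `V` by slots, r16's `Eq551` composed with r18's `sigmaOp` — literally
`σ_k·∂₁ = Q^e_k·∂·H_k` for the embedded operators — holds, from (I.5.3.1), (I.6.1.4), `∂Q^{s*}_k = Q^{e*}_k∂₁` (dictionary `Slot`/`emb`,
`sigmaOp_emb`, `emb_mul` of `BIJ88Eq215Proof`). [cite: BalabanImbrieJaffe1988, (5.5.1) p.283] -/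
theorem eq551_emb (sB : Slot (𝕜 := 𝕜) B₁ V) (sA : Slot (𝕜 := 𝕜) A V) (s₁ : Slot (𝕜 := 𝕜) P₁ V) (sη : Slot (𝕜 := 𝕜) Pη V)
    (d₁ : B₁ →ₗ[𝕜] P₁) (dη : A →ₗ[𝕜] Pη) (dηs : Pη →ₗ[𝕜] A) (G : A →ₗ[𝕜] A) (Qek : Pη →ₗ[𝕜] P₁)
    (Qeks : P₁ →ₗ[𝕜] Pη) (Qss Hax Hk : B₁ →ₗ[𝕜] A) (h531 : Hax = Qss - G ∘ₗ dηs ∘ₗ Qeks ∘ₗ d₁)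
    (h614 : dη ∘ₗ Hax = dη ∘ₗ Hk) (hdQ : dη ∘ₗ Qss = Qeks ∘ₗ d₁) :
    Eq551 (sigmaOp (emb s₁ sη Qek) (emb sη s₁ Qeks) (emb sη sA dη) (emb sA sη dηs) (emb sA sA G))
      (emb s₁ sB d₁) (emb s₁ sη Qek) (emb sη sA dη) (emb sA sB Hk) := by
  unfold Eq551
  rw [sigmaOp_emb, emb_mul, emb_mul, emb_mul, eq551_lin d₁ dη dηs G Qek Qeks Qss Hax Hk h531 h614 hdQ,
    LinearMap.comp_assoc]

end Lin

end Literature.MathematicalPhysics.QuantumFieldTheory.BalabanImbrieJaffe1984to88.BIJ88Eq551Proof
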